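import Summits.CriticalPhenomena.SAWScalingLimit.Theorems.SAWTotalPositivityBoundaryTP2Strip4EndC
import Summits.CriticalPhenomena.SAWScalingLimit.Theorems.SAWTotalPositivityBoundaryTP2RectFacingPairs
import Literature.Probability.RandomPlanarGeometry.SelfAvoidingWalkProofs
import HarnessLib

/-!
# Crux `BoundaryTP2` (stmt-CriticalPhenomena-7115), line `Sketch`: END-PAIR labelling on the 4-row strips, part D — **the crux
`BoundaryTP2` AS TYPED on EVERY two-left/two-right quadruple of EVERY 4-row strip, first labelling** (end pairs on the right;
with `boundaryTP2_strip4` of …Strip4TP2 this covers BOTH labellings) (lead c6)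

For `p₁ = (0,j₁), p₂ = (0,j₂)` (left, `j₂ < j₁`), `p₃ = (n,j₃), p₄ = (n,j₄)` (right, `j₃ < j₄`), `n ≥ 1`: the typed hypotheses hold and
`Z(p₁,p₃) Z(p₂,p₄) ≤ Z(p₁,p₂) Z(p₃,p₄)` at `x_c` given `x_c ≤ 5/13` (`boundaryTP2_strip4_facing`), from the kernel form
`strip4_endPair` (36 instances = thirteen inequalities in the letters and the four canonical end kernels, `strip4_endForms_real`). [folklore]
-/

noncomputable section

namespace Summit.CriticalPhenomena.SAWScalingLimit.Theorems.BoundaryTP2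

open Literature.Probability.LatticeModels Literature.Probability.RandomPlanarGeometry
open Summit.CriticalPhenomena.SAWScalingLimit.Theorems.EdgeOfPositivity.Negative
open Summit.CriticalPhenomena.SAWScalingLimit.Theorems.BoundaryTP2.Negative.Cert
open Summit.CriticalPhenomena.SAWScalingLimit.Theorems.BoundaryTP2.StripCert
open scoped ENNReal

/-! ## §25 The end-pair inequality in kernel form, and the crux as typed (first labelling) -/

set_option maxHeartbeats 1600000 in
set_option linter.unusedSimpArgs false in
/-- **END-PAIR TP₂ on every 4-row strip**: for `n ≥ 1`, `0 ≤ j₂ < j₁ ≤ 3`, `0 ≤ j₃ < j₄ ≤ 3` and `x ∈ [1/3, 5/13]`,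
`Z((0,j₁),(n,j₃)) · Z((0,j₂),(n,j₄)) ≤ Z((0,j₁),(0,j₂)) · Z((n,j₃),(n,j₄))`. [folklore] -/
theorem strip4_endPair (n : ℕ) (hn : 1 ≤ n) {x : ℝ} (hx1 : 1 / 3 ≤ x) (hx2 : x ≤ 5 / 13) {j₁ j₂ j₃ j₄ : ℤ}
    (h₂ : 0 ≤ j₂) (h₂₁ : j₂ < j₁) (h₁ : j₁ ≤ 3) (h₃ : 0 ≤ j₃) (h₃₄ : j₃ < j₄) (h₄ : j₄ ≤ 3) :
    pathKernel (discreteDomainGraph (rectDomain n 3) 1) x (st 0 j₁) (st n j₃) * pathKernel (discreteDomainGraph (rectDomain n 3) 1) x (st 0 j₂) (st n j₄) ≤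
      pathKernel (discreteDomainGraph (rectDomain n 3) 1) x (st 0 j₁) (st 0 j₂) * pathKernel (discreteDomainGraph (rectDomain n 3) 1) x (st n j₃) (st n j₄) := by
  obtain ⟨g0, g1, g2, g3, g4, g5, g6, g7, g8, g9, g10, g11, g12⟩ := strip4_endForms_real n hn hx1 hx2
  obtain ⟨t10, t20, t30, t13, t21, t22, t23, t31, t32, t33⟩ := strip4_table n x
  have fin := strip4_ne_top n x
  have R := strip4_rightEnd n x
  have V := strip4_vert0 n x
  have C := pathKernel_comm (discreteDomainGraph (rectDomain n 3) 1) x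
  -- left ends to canonical: (1,0),(2,0),(3,0) by comm; (2,1) comm; (3,1) -> V -> (0,2); (3,2) -> V -> (0,1)
  have l10 : pathKernel (discreteDomainGraph (rectDomain n 3) 1) x (st 0 1) (st 0 0) = pathKernel (discreteDomainGraph (rectDomain n 3) 1) x (st 0 0) (st 0 1) := C _ _
  have l20 : pathKernel (discreteDomainGraph (rectDomain n 3) 1) x (st 0 2) (st 0 0) = pathKernel (discreteDomainGraph (rectDomain n 3) 1) x (st 0 0) (st 0 2) := C _ _
  have l30 : pathKernel (discreteDomainGraph (rectDomain n 3) 1) x (st 0 3) (st 0 0) = pathKernel (discreteDomainGraph (rectDomain n 3) 1) x (st 0 0) (st 0 3) := C _ _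
  have l21 : pathKernel (discreteDomainGraph (rectDomain n 3) 1) x (st 0 2) (st 0 1) = pathKernel (discreteDomainGraph (rectDomain n 3) 1) x (st 0 1) (st 0 2) := C _ _
  have l31 : pathKernel (discreteDomainGraph (rectDomain n 3) 1) x (st 0 3) (st 0 1) = pathKernel (discreteDomainGraph (rectDomain n 3) 1) x (st 0 0) (st 0 2) := by
    rw [V 3 1]; norm_num
  have l32 : pathKernel (discreteDomainGraph (rectDomain n 3) 1) x (st 0 3) (st 0 2) = pathKernel (discreteDomainGraph (rectDomain n 3) 1) x (st 0 0) (st 0 1) := by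
    rw [V 3 2]; norm_num
  -- right ends to canonical left ends
  have r01 : pathKernel (discreteDomainGraph (rectDomain n 3) 1) x (st n 0) (st n 1) = pathKernel (discreteDomainGraph (rectDomain n 3) 1) x (st 0 0) (st 0 1) := R 0 1
  have r02 : pathKernel (discreteDomainGraph (rectDomain n 3) 1) x (st n 0) (st n 2) = pathKernel (discreteDomainGraph (rectDomain n 3) 1) x (st 0 0) (st 0 2) := R 0 2
  have r03 : pathKernel (discreteDomainGraph (rectDomain n 3) 1) x (st n 0) (st n 3) = pathKernel (discreteDomainGraph (rectDomain n 3) 1) x (st 0 0) (st 0 3) := R 0 3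
  have r12 : pathKernel (discreteDomainGraph (rectDomain n 3) 1) x (st n 1) (st n 2) = pathKernel (discreteDomainGraph (rectDomain n 3) 1) x (st 0 1) (st 0 2) := R 1 2
  have r13 : pathKernel (discreteDomainGraph (rectDomain n 3) 1) x (st n 1) (st n 3) = pathKernel (discreteDomainGraph (rectDomain n 3) 1) x (st 0 0) (st 0 2) := by
    rw [R 1 3, V 1 3]; norm_num; exact C _ _
  have r23 : pathKernel (discreteDomainGraph (rectDomain n 3) 1) x (st n 2) (st n 3) = pathKernel (discreteDomainGraph (rectDomain n 3) 1) x (st 0 0) (st 0 1) := by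
    rw [R 2 3, V 2 3]; norm_num; exact C _ _
  have hj1 : 1 ≤ j₁ := by omega
  have hj2 : j₂ ≤ 2 := by omega
  have hj3 : j₃ ≤ 2 := by omega
  have hj4 : 1 ≤ j₄ := by omega
  interval_cases j₁ <;> interval_cases j₂ <;> interval_cases j₃ <;> interval_cases j₄
  all_goals try simp only [t10, t20, t30, t13, t21, t22, t23, t31, t32, t33, l10, l20, l30, l21, l31, l32,
    r01, r02, r03, r12, r13, r23]
  all_goals refine s4tp_mul_le (fin _ _) (fin _ _) (fin _ _) (fin _ _) ?_
  all_goals linarith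

/-- **The crux `BoundaryTP2` AS TYPED on every 4-row strip, first labelling** (`p₁ = (0,j₁)`, `p₂ = (0,j₂)` left,
`p₃ = (n,j₃)`, `p₄ = (n,j₄)` right; `j₂ < j₁`, `j₃ < j₄`, `n ≥ 1`): the three hypotheses hold as typed and the conclusion
`Z(p₁,p₃) Z(p₂,p₄) ≤ Z(p₁,p₂) Z(p₃,p₄)` (end pairs on the right) holds at `x_c`, given `x_c ≤ 5/13`.  Together with
`boundaryTP2_strip4` (the other labelling) this is the crux on EVERY quadruple with two marked points on each vertical
side of EVERY 4-row strip. [folklore] -/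
theorem boundaryTP2_strip4_facing (hxc : SAW.criticalFugacity ≤ 5 / 13) (n : ℕ) (hn : 1 ≤ n) {j₁ j₂ j₃ j₄ : ℤ}
    (h₂ : 0 ≤ j₂) (h₂₁ : j₂ < j₁) (h₁ : j₁ ≤ 3) (h₃ : 0 ≤ j₃) (h₃₄ : j₃ < j₄) (h₄ : j₄ ≤ 3) :
    (∀ (P : SAW.DomainSAW (rectDomain n 3) 1 (st 0 j₁) (st n j₃))
        (Q : SAW.DomainSAW (rectDomain n 3) 1 (st 0 j₂) (st n j₄)),
        ∃ v, v ∈ P.walk.support ∧ v ∈ Q.walk.support) ∧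
    (∃ (P : SAW.DomainSAW (rectDomain n 3) 1 (st 0 j₁) (st 0 j₂))
        (Q : SAW.DomainSAW (rectDomain n 3) 1 (st n j₃) (st n j₄)),
        List.Disjoint P.walk.support Q.walk.support) ∧
    (∃ (P : SAW.DomainSAW (rectDomain n 3) 1 (st 0 j₁) (st n j₄))
        (Q : SAW.DomainSAW (rectDomain n 3) 1 (st 0 j₂) (st n j₃)),
        List.Disjoint P.walk.support Q.walk.support) ∧
    SAW.weight (rectDomain n 3) 1 (st 0 j₁) (st n j₃) Set.univ *
        SAW.weight (rectDomain n 3) 1 (st 0 j₂) (st n j₄) Set.univ ≤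
      SAW.weight (rectDomain n 3) 1 (st 0 j₁) (st 0 j₂) Set.univ *
        SAW.weight (rectDomain n 3) 1 (st n j₃) (st n j₄) Set.univ := by
  obtain ⟨hI, hD₁, hD₂⟩ := stub_rect_facingPairs n 3 hn h₂ h₂₁ h₁ h₃ h₃₄ h₄
  refine ⟨fun P Q => hI ⟨P.walk, P.isPath⟩ ⟨Q.walk, Q.isPath⟩, ?_, ?_, ?_⟩
  · obtain ⟨P, Q, hPQ⟩ := hD₁
    exact ⟨⟨P.1, P.2⟩, ⟨Q.1, Q.2⟩, by simpa using hPQ⟩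
  · obtain ⟨P, Q, hPQ⟩ := hD₂
    exact ⟨⟨P.1, P.2⟩, ⟨Q.1, Q.2⟩, by simpa using hPQ⟩
  · simp only [weight_univ_eq_pathKernel]
    exact strip4_endPair n hn SAW.one_third_le_criticalFugacity hxc h₂ h₂₁ h₁ h₃ h₃₄ h₄

end Summit.CriticalPhenomena.SAWScalingLimit.Theorems.BoundaryTP2
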